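import Mathlib
import HarnessLib

/-!
# Hodge-locus census — kernel dictionary identities (lead seat ivhs-1, gen 31 supplement)

HONEST FRAMING: certified instances and evidence bearing on the general Hodge conjecture; no claim.

Def-free certificates of the closed-form identities behind THEOREM D and COROLLARY D2 of the record
`og81/MU0-SURFACES-ALLD-g31.md` §8 (the dictionary between the two census kernels at the Fermat point:
engine B = Griffiths–Dwork reduction + Villaflor's Jacobian-determinant class, engine A = the
Movasati / Movasati–Villaflor period rule):

* `pair_coeff` — the coefficient identity behind `det Jac (x_u - c x_v, g) = d · u_c`:
  the coefficient of `c^(l+1) x_u^(d-2-l) x_v^l` in `∂_v g + c ∂_u g` is `(l+1) + (d-1-l) = d`;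
* `constant_identity`, `constant_ratio` — the combinatorial constant of THEOREM D:
  `(-1)^r · C(j+r-1, r) · r! · (k-1)!/(j+r-1)! = (-1)^r (k-1)!/(j-1)!` (written with `j = j' + 1`);
* `minor_closed_form`, `m_pq`, `m_qt`, `m_qt_eq` — the block-4 minors of the surface rows
  `m(b,b') = λ (z²-1) z^(7+b+b') (z^(2b') - z^(2b))`, `m_pq = λ z⁸ (z²-1)²`, `m_qt = z⁴ · m_pq`;
* `engineD_constant` — COROLLARY D2: with `z^d = -1`, `d² z^(d-6) · m_pq = (-d² z^(2d-10)) · m_qt`,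
  i.e. engine D's printed certificate is `-d² z^(2d-10)` times engine C's, for every `d ≥ 6`.

[cite: arXiv:1812.03964, Thm 1] [cite: arXiv:1705.00084, Thm 1] [cite: arXiv:1602.06607, Thm 15]
-/

namespace Summit.HodgeConjecture.HodgeConjecture.HodgeLocus.Census.KernelDictionary

/-- Coefficient identity behind `det Jac = d · u_c` for one pair of the Fermat presentation. -/
theorem pair_coeff (d l : ℕ) (h : l + 1 ≤ d) : (l + 1) + (d - 1 - l) = d := by
  omega

/-- THEOREM D's constant, multiplied out in `ℕ` (with `j = j' + 1`):
`C(j'+r, r) · r! · j'! = (j'+r)!`. -/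
theorem constant_identity (j' r : ℕ) :
    Nat.choose (j' + r) r * Nat.factorial r * Nat.factorial j' = Nat.factorial (j' + r) := by
  have h := Nat.choose_mul_factorial_mul_factorial (Nat.le_add_left r j')
  simpa [Nat.add_sub_cancel] using h

/-- THEOREM D's constant as a rational identity (with `j = j' + 1`, `k = k' + 1`):
`(-1)^r · C(j'+r, r) · r! · k'! / (j'+r)! = (-1)^r · k'! / j'!`. -/
theorem constant_ratio (k' j' r : ℕ) :
    (-1 : ℚ) ^ r * (Nat.choose (j' + r) r : ℚ) * (Nat.factorial r : ℚ) * (Nat.factorial k' : ℚ)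
        / (Nat.factorial (j' + r) : ℚ)
      = (-1 : ℚ) ^ r * (Nat.factorial k' : ℚ) / (Nat.factorial j' : ℚ) := by
  have hj : (Nat.factorial j' : ℚ) ≠ 0 := by positivity
  have hjr : (Nat.factorial (j' + r) : ℚ) ≠ 0 := by positivity
  have h : (Nat.choose (j' + r) r : ℚ) * (Nat.factorial r : ℚ) * (Nat.factorial j' : ℚ)
      = (Nat.factorial (j' + r) : ℚ) := by
    exact_mod_cast constant_identity j' r
  rw [div_eq_div_iff hjr hj]
  calc (-1 : ℚ) ^ r * (Nat.choose (j' + r) r : ℚ) * (Nat.factorial r : ℚ) * (Nat.factorial k' : ℚ)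
          * (Nat.factorial j' : ℚ)
        = (-1 : ℚ) ^ r * (Nat.factorial k' : ℚ)
          * ((Nat.choose (j' + r) r : ℚ) * (Nat.factorial r : ℚ) * (Nat.factorial j' : ℚ)) := by ring
    _ = (-1 : ℚ) ^ r * (Nat.factorial k' : ℚ) * (Nat.factorial (j' + r) : ℚ) := by rw [h]

variable {K : Type*} [Field K]

/-- The block-4 minor of the surface rows in closed form: with `c₀(b) = z^(b+2) + λ z^(3b+4)` and
`c₁(b) = z^(b+3) + λ z^(3b+7)`, `c₀(b) c₁(b') - c₁(b) c₀(b') = λ (z²-1) z^(7+b+b') (z^(2b') - z^(2b))`. -/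
theorem minor_closed_form (lam z : K) (b b' : ℕ) :
    (z ^ (b + 2) + lam * z ^ (3 * b + 4)) * (z ^ (b' + 3) + lam * z ^ (3 * b' + 7))
      - (z ^ (b + 3) + lam * z ^ (3 * b + 7)) * (z ^ (b' + 2) + lam * z ^ (3 * b' + 4))
      = lam * (z ^ 2 - 1) * z ^ (7 + b + b') * (z ^ (2 * b') - z ^ (2 * b)) := by
  ring

/-- `m_pq = m(0,1) = λ z⁸ (z²-1)²`. -/
theorem m_pq (lam z : K) :
    (z ^ 2 + lam * z ^ 4) * (z ^ 4 + lam * z ^ 10) - (z ^ 3 + lam * z ^ 7) * (z ^ 3 + lam * z ^ 7)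
      = lam * z ^ 8 * (z ^ 2 - 1) ^ 2 := by
  ring

/-- `m_qt = m(1,2) = λ z¹² (z²-1)²`. -/
theorem m_qt (lam z : K) :
    (z ^ 3 + lam * z ^ 7) * (z ^ 5 + lam * z ^ 13) - (z ^ 4 + lam * z ^ 10) * (z ^ 4 + lam * z ^ 10)
      = lam * z ^ 12 * (z ^ 2 - 1) ^ 2 := by
  ring

/-- `m_qt = z⁴ · m_pq`. -/
theorem m_qt_eq (lam z : K) :
    lam * z ^ 12 * (z ^ 2 - 1) ^ 2 = z ^ 4 * (lam * z ^ 8 * (z ^ 2 - 1) ^ 2) := by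
  ring

/-- COROLLARY D2 (engine D's constant for every `d ≥ 6`): the certificate of engine D is read at the
pair-swapped row (row factor `z^(d-6)`, pivots of the other two types, minor `m_qt`), engine C's at
`β₀ = 0` with minor `m_pq`; with `z^d = -1` the two Schur quotients differ by exactly `-d² z^(2d-10)`:
`d² z^(d-6) · m_pq = (-d² z^(2d-10)) · m_qt` (both sides multiplied by `m_pq m_qt / det₃`). -/
theorem engineD_constant (d : ℕ) (hd : 6 ≤ d) (lam z : K) (hz : z ^ d = -1) :
    (d : K) ^ 2 * z ^ (d - 6) * (lam * z ^ 8 * (z ^ 2 - 1) ^ 2)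
      = -((d : K) ^ 2 * z ^ (2 * d - 10)) * (lam * z ^ 12 * (z ^ 2 - 1) ^ 2) := by
  obtain ⟨e, rfl⟩ : ∃ e, d = e + 6 := ⟨d - 6, by omega⟩
  have h1 : e + 6 - 6 = e := by omega
  have h2 : 2 * (e + 6) - 10 = 2 * e + 2 := by omega
  rw [h1, h2]
  have h3 : z ^ (2 * e + 2) * z ^ 12 = z ^ e * z ^ 8 * z ^ (e + 6) := by ring
  calc ((e + 6 : ℕ) : K) ^ 2 * z ^ e * (lam * z ^ 8 * (z ^ 2 - 1) ^ 2)
        = -(((e + 6 : ℕ) : K) ^ 2 * lam * (z ^ 2 - 1) ^ 2) * (z ^ e * z ^ 8 * z ^ (e + 6)) := by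
          rw [hz]; ring
    _ = -(((e + 6 : ℕ) : K) ^ 2 * z ^ (2 * e + 2)) * (lam * z ^ 12 * (z ^ 2 - 1) ^ 2) := by
          rw [← h3]; ring

end Summit.HodgeConjecture.HodgeConjecture.HodgeLocus.Census.KernelDictionary
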